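import Mathlib
import HarnessLib
import HarnessLib.Audit
import Summits.MatrixMultiplication.Statement
import Literature.Computability.AlgebraicComplexity.RectangularExponent
import Literature.Computability.AlgebraicComplexity.RectangularExponentSubadditivity
import Literature.Computability.AlgebraicComplexity.RectangularExponentAlpha
import Literature.Computability.AlgebraicComplexity.BorderRankCW
import Literature.Computability.AlgebraicComplexity.AsymptoticSpectrum
import HarnessLib.Audit.Status.Attr

/-!
Route: FarEdgeDescent

# Route FarEdgeDescent — ω = 2 iff the Lotti–Romani infimum is attained and the rectangular excess
is log-convex FROM THE SQUARE on the real shape axis (gen 6: no square link)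

It suffices to show X = FiniteSaturation ∧ AnchoredLogConvexity (and S ⟺ X, kernel `node_gen6_iff`
in the lens draft HOME/decomp-mm-lens-2/FarEdgeDescent_v6.lean).
Axis: the REAL shape exponent x of ⟨n, n^x, n⟩, ω(1,x,1) = omegaRect ℂ 1 x 1, excess e(x) :=
ω(1,x,1) − (x+1) ≥ 0 (e(1) = ω − 2; x ↦ ω(1,x,1) convex, non-decreasing, 1-Lipschitz, e → 0 — all
PROVED in the tree: Lotti–Romani / Coppersmith / Huang–Pan, `LottiRomani1983_convexComb_le`,
`omegaRect_one_mid_one_le_add`, `perfectAmortisation_proof`).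
SPECIAL side (transversality at the far edge): FiniteSaturation = ∃ integer k ≥ 2 with e(k) = 0
(split gen 1: ⟸ PowerAmortisation ∧ OctaveFlatness, glue stmt-25349 LANDED).
GENERIC side (roundness seen from the square): AnchoredLogConvexity = ∀ real m > 1, e(m)² ≤
e(1)·e(2m−1) — the three-term log-convexity of e at 1 < m < 2m−1 (step h = m−1); it never evaluates
a shape below the square, so it is neither the old residual SquareLink (= the e-form ACROSS the
square at (0,1,2), kernel `squareLink_iff_across`) nor the summit (= the d-form across the square,
`dualDefectAcross_iff_mm`).
Lean: `(∃ k : ℕ, 2 ≤ k ∧ Literature.Computability.AlgebraicComplexity.omegaRect ℂ 1 k 1 = k + 1) ∧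
(∀ m : ℝ, 1 < m → (Literature.Computability.AlgebraicComplexity.omegaRect ℂ 1 m 1 - (m + 1)) ^ 2 ≤
(Literature.Computability.AlgebraicComplexity.omegaRect ℂ 1 1 1 - 2) *
(Literature.Computability.AlgebraicComplexity.omegaRect ℂ 1 (2 * m - 1) 1 - 2 * m))`

## Assembly
Halving descent: let k₀ ≥ 2 be the integer of FiniteSaturation, e(k₀) = 0. AnchoredLogConvexity at m
= (k₀+1)/2 gives e(m)² ≤ e(1)·e(k₀) = 0, so e((k₀+1)/2) = 0; iterating, e(k_n) = 0 along the orbit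
k_n = 1 + (k₀−1)/2ⁿ → 1⁺. The square is closed by a THEOREM, not a link: Lotti–Romani convexity of x
↦ ω(1,x,1) on [0, k_n] (weights 1 − 1/k_n, 1/k_n) with the anchor ω(1,0,1) = 2 (tree
`omegaRect_one_zero_one`) gives ω = ω(1,1,1) ≤ 3 − 1/k_n for every n, hence ω ≤ 2, and ω ≥ 2
(`add_one_le_omegaRect_one_mid_one`). Conversely ω = 2 makes every ω(1,x,1) = x+1 for x ≥ 1
(sandwich), whence both pieces. The deciding theorem `closes` (glue_v6.lean, 76 lines, axioms
standard, certified native) consumes exactly the two cruxes; the rev-2 pieces ExcessLogConvexity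
(integer slice, now aside) and SquareLink (dropped here, kept by OctaveBudget) are no longer in the
cone.

Rationale: WHY THIS LINE. (gen 6) A log-convex profile that vanishes at one shape vanishes at every shape
between it and the anchor: e(m)² ≤ e(1)·e(2m−1) with e(2m−1) = 0 forces e(m) = 0, and on the REAL
shape axis the zero HALVES its distance to the square indefinitely; continuity-with-convexity AT the
square (Lotti–Romani, anchor ω(1,0,1) = 2, PROVED) then gives ω = 2 with no square link. So ω = 2 is
cut EXACTLY into «the Lotti–Romani infimum β is attained» (transversal contact of the spectrum of
shapes with the far edge: LottiRomani1983 Prop. 4.1, Coppersmith1982, HuangPan1998 §8) and «the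
excess is log-convex seen from the square» (a ROUNDNESS law one notch above the proved convexity:
additive interpolation of algorithms gives the chord, the piece asks for a MULTIPLICATIVE
interpolation of defects). Each side holds in named ω > 2 model profiles obeying every proved law (β
< ∞ in the one-dark-vertex polytope model, β ≈ 2.77, where the law fails by the slope² term; the law
in every smooth power / exponential / log world, where β = ∞) and their conjunction is ω = 2 (kernel
`node_gen6_iff`). HONESTY: the content `closes` uses of the law is its zero-propagation skeleton,
certified EQUAL to the residual (`hzp_iff_residual`; = SaturationLadder's FiniteToSquare,
`hzp_iff_finiteToSquare`) — as for any complement of a zero-producing special piece; the surplus is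
the inequality in zero-free worlds, a uniform law with an instrument (T2ʳ margins ≈ 0.54(m−1)² in
the CW_q first-power world; printed VXXZ-2024 profile RA(1.1) = 1.0044, RA(1.5) = 1.069, RA(2) =
1.178).

RANKED CRUXES. #2 AnchoredLogConvexity (crux, stmt-28900) — GENERIC, real axis, anchored: ∀ m > 1,
(ω(1,m,1) − m − 1)² ≤ (ω − 2)(ω(1,2m−1,1) − 2m). WEAKER·NEC·INSTRUMENTED(T2ʳ,
T2ʳ-print)·IDEA-NEEDED; fails in kink/polytope worlds. [XL] #3 FiniteSaturation (crux, stmt-23739,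
SHARED) — SPECIAL: ∃ k ≥ 2, ω(1,k,1) = k+1; split ⟸ #301 PowerAmortisation (∃δ>0: e(k) ≤ C k^−δ;
ATTACKABLE-IN-CLASS verdict census I13: in-class closed, idea card little-cw-deficiency-ladder
attached) ∧ #302 OctaveFlatness; glue #303 LANDED. WEAKER·NEC·BARRIER(CW_q)·IDEA-NEEDED.
[open-problem] Asides (banked, never staffed): ExcessLogConvexity 23738 (rev-2 integer slice,
superseded in the cone by #2), LogRate 25370 (LANDED), SubLogRate 25371, SuperExpContact 28901 (new
rung: liminf e(k)^{1/k} = 0, the special binder of the certified deeper cut B `closes_superexp`),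
RealLogConvexity 28902 (the full law, C⁺ of #2 and of 23738).

KILL CRITERIA. A refutation of AnchoredLogConvexity (true values with e(m)² > e(1)e(2m−1) — needs a
LOWER bound on some ω(1,m,1) beyond m+1 together with upper bounds; none exist) closes the route
refuted:AnchoredLogConvexity; a proof that β = ∞ (e(k) > 0 for all k) refutes FiniteSaturation (and
SuperExpContact decides whether cut B survives). A proof of E_k for any k ≥ 2 contracts the route to
AnchoredLogConvexity on (1, k] alone.

NOT DECOMPOSED YET. The multiplicative-interpolation mechanism behind the law (which tensor
construction interpolates defects geometrically between ⟨n,n,n⟩ and ⟨n,n^{2m−1},n⟩); the re-homing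
of PowerAmortisation/OctaveFlatness under SuperExpContact that would serve cut B (S ⟺
SuperExpContact ∧ RealLogConvexity, kernel ready) — a gate-level restructuring left to OPS/writer;
the spectral reading (β < ∞ ⟺ polyhedral/transversal contact; the law ⟺ a curvature condition h·h″ ≥
h′² on the support function near the edge) stays informal.

CHEAPEST FALSIFIER. T2ʳ in any self-consistent method world with real shapes near the square: is
RA(m) = ê(1)ê(2m−1)/ê(m)² ≥ 1 as m → 1⁺? Run (seconds, local): CW_q first power, real q: yes, margin
0.54(m−1)²; VXXZ-2024 printed fourth-power profile: yes at m = 1.1, 1.5, 2. A fourth-power CW_5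
laser re-optimisation at κ ∈ {1.05, 1.1, 1.2} (census/kit, ≈ 10 core-h) would test the bite region
with the sharpest in-class profile; a violation there removes the law's only structural evidence.

Novelty: Searches (2026-08-30, gen 0 + gen 6): rg over all Theses/*.lean and Ideas of the sub for
"log-convex|logconvex|modulus|descent|omegaRect ℂ 1 . 1|real shape|halving" (hits:
TallFlatOnset.ExcessDoubling = two-term integer doubling e(k) ≤ C·e(2k) incl. k = 1, i.e. it
CONTAINS a square link; SaturationLadder.FiniteToSquare = the bare residual FS → S; OctaveBudget =
RATE ∧ TAIL-CAP ∧ SquareLink; none on real shapes, none anchored); `ledger negatives --problem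
MatrixMultiplication` (12, none on the exponent profile); lit search --hybrid "rectangular matrix
multiplication exponent log-convex" / vsearch "log-convexity of the exponent of rectangular matrix
multiplication as a function of the shape" (corpus: BCS 1997 p.452 Problem 15.4 [log-convexity
questions for Δ, a different object], p.410, p.456; LottiRomani1983 via BCS [342]; HuangPan1998 §8;
Landsberg 2017 ch. 3 — no real-variable log-convexity statement for ω(1,k,1)); lit galaxy search
"ω(1,k,1)|omega(1,k,1)|rectangular matrix multiplication exponent" and "log-convex function of
k|logarithmically convex in k" --star all (no relevant hits); CLLZ 2025 Rem. 3.13 (continuity /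
Lipschitz in p, used as a theorem, not the law).
Nearest prior art found: LottiRomani1983 §1 / Prop. 4.1 (convexity of x ↦ ω(1,x,1) and the limit —
the ADDITIVE interpolation this law sharpens); this route's own rev 2 (integer ExcessLogConvexity +
SquareLink); TallFlatOnset.ExcessDoubling (integer halving with a constant, crossing the square).
Delta: passing  [refs: LottiRomani1983, HuangPan1998]

Barriers (technique_class: rectangular-exponents, spectrum-geometry, interpolation): - technique_class: rectangular-exponents, spectrum-geometry, interpolation
- Literature.Barriers.MatrixMultiplication.RectangularBarrier: bites FiniteSaturation for every CW_q
T-method at every finite k (`IsAdequate.barrier`, `CLLZ2025_omegaTwo_barrier_CW`); it does not: the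
bet is a tensor family R̃-sharp on two legs outside the CW_q class; ExcessLogConvexity / SquareLink
are inequalities BETWEEN exponents, outside the class (they certify no single exponent).
- Literature.Barriers.MatrixMultiplication.UniversalMethodBarrier: stated for ω from a fixed tensor;
the generic pieces use no fixed starting tensor (outside); FiniteSaturation inherits it exactly as
the summit does via its rectangular form (CLLZ).
- Literature.Barriers.MatrixMultiplication.IrreversibilityBarrier: same placement as
UniversalMethodBarrier (rectangular analogue = CLLZ).
- Literature.Barriers.MatrixMultiplication.InfimumNotMinimumBarrier: outside — FiniteSaturation is
an infimum over algorithms at a fixed shape exponent, not a fixed-format rank certificate;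
"attained" refers to the shape infimum β.
- Negatives index: 12 refuted statements (HyperoctahedralThreshold, TightWindows,
PrimeValConjecture, ModuleRankGrowth, HexagonClearance, ConeDesignThesis, RectangularThmB,
SeparableDesignsMultiplicative, SubgroupTriples, LevelTwoBeatsCubes, ExactLineDesign,
ExactFrameDesign) — none concerns the excess profile; ModuleRankGrowth (superlinear module rank,
refuted by perfect amortisation) is the opposite bet to Fin

History (route lifecycle, newest last):
- 2026-08-30T06:01:52Z · rev 4: restated Assembly (stmt-MatrixMultiplication-23741) — gen 6 step 2/3: Assembly restated to the gen-6 cut (FiniteSaturation → AnchoredLogConvexity → S) so that SquareLink can be dropped from this route in step 3. (planner-decomp-mm-lens-2-g6-0)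
- 2026-08-30T06:02:53Z · rev 5: dropped SquareLink — gen 6 step 3/3 (decomp-mm-lens-2-g6): NEW CUT closes (h₁ : FiniteSaturation) (h₂ : AnchoredLogConvexity) : _root_.MatrixMultiplication (glue_v6.lean, certified (planner-decomp-mm-lens-2-g6-0)

sub-problem: MatrixMultiplication · status: open · opened planner-decomp-mm-lens-2-g0-0 2026-08-30T01:29:02Z · rev 13 · ledger route-MatrixMultiplication-FarEdgeDescent
GENERATED by the gate from the ledger (D-0016/17). Provers cite these decls: `theorem foo : Summit.MatrixMultiplication.MatrixMultiplication.Theses.FarEdgeDescent.<Decl> := …` in Summits/MatrixMultiplication/MatrixMultiplication/Theorems/<Name>.lean.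
-/

namespace Summit.MatrixMultiplication.MatrixMultiplication.Theses.FarEdgeDescent

open scoped BigOperators Topology Manifold Classical MeasureTheory ProbabilityTheory Matrix InnerProductSpace ComplexConjugate ContinuousMap
open Filter Set Function TopologicalSpace MeasureTheory

attribute [summit_statement] _root_.MatrixMultiplication

/-- item stmt-MatrixMultiplication-28900 · crux · rank 2 · open · by planner
why it might fail: ω > 2 with a polyhedral spectrum body near the far edge: e affine on a right-neighbourhood of the square (deficit s²(m−1)²) or a transversal zero at finite β > 1 (one-dark-vertex β ≈ 2.77); no multiplicative interpolation of algorithms is known.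
sources: LottiRomani1983, HuangPan1998, ChristandlLeGallLysikovZuiddam2025, VassilevskaWilliamsXuXuZhou2024, BurgisserClausenShokrollahi1997, Strassen1988
[crux · gen 6 · GENERIC side on the REAL shape axis, ANCHORED AT THE SQUARE · replaces in the cone
both rev-2's integer slice ExcessLogConvexity (stmt-23738 → aside) and the declared residual
SquareLink (stmt-23740, dropped from this route; it stays on OctaveBudget) · tag NEC (S ⟹ it, kernel
`anchoredLogConvexity_of_mm` in the lens draft HOME/decomp-mm-lens-2/FarEdgeDescent_v6.lean); WEAKER
— holds identically in every smooth ω>2 model profile obeying the PROVED profile laws (power world e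
= c·k^(−δ): (2m−1)^δ ≤ m^(2δ); exponential world: equality; log world e = c·log2/log 2k:
log2·log(4m−2) ≤ log²(2m)) and FAILS in kink worlds (transversal zero at finite β > 1 with ω > 2:
one-dark-vertex β ≈ 2.77, lens-5's W₁/W₂ — exactly where FiniteSaturation holds) and in polytope
worlds (e affine on a right-neighbourhood of 1 with slope s ≠ 0: deficit s²(m−1)²); incomparable
with SquareLink (power world δ = 2, c = 0.37: this ✓, SL ✗; soft-kink zero-free world e(1) = .37,
e(1.5) = .2, e(2) = .1: this ✗) · HONESTY: the content `closes` USES is the halving zero-propagation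
e(2m−1) = 0 ⟹ e(m) = 0, certified EQUAL to the residual (kernels `hzp_iff_residual :
HalvingZeroPropagation ⟺ (RealSaturation -/
@[route_item "route-MatrixMultiplication-FarEdgeDescent", crux]
def AnchoredLogConvexity : Prop :=
  ∀ m : ℝ, 1 < m → (Literature.Computability.AlgebraicComplexity.omegaRect ℂ 1 m 1 - (m + 1)) ^ 2 ≤ (Literature.Computability.AlgebraicComplexity.omegaRect ℂ 1 1 1 - 2) * (Literature.Computability.AlgebraicComplexity.omegaRect ℂ 1 (2 * m - 1) 1 - 2 * m)

/-- item stmt-MatrixMultiplication-23739 · crux · rank 3 · SPLIT (gen 1) into PowerAmortisation, OctaveFlatness + glue FiniteSaturationGlue · direct attempts still welcome (low priority) · by planner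
why it might fail: β = ∞ — the spectrum of shapes may touch the edge {θ₁+θ₂ = 1} tangentially (e(k) ~ c/k, as the O(1/k) decay of every CW_q bound suggests); every CW_q restriction method is barred at every finite k and no tensor family R̃-sharp on two legs is known.
sources: LottiRomani1983, Coppersmith1982, VassilevskaWilliamsXuXuZhou2024, ChristandlLeGallLysikovZuiddam2025
[crux] SPECIAL side — the Lotti–Romani infimum is attained: some unbalanced product ⟨n, n^k, n⟩ with
integer k ≥ 2 has exactly the information exponent, ω(1,k,1) = k + 1 (β := inf{k : e(k) = 0} < ∞;
the k* of the closed card far-edge-kstar-amortised-matvec). Tag WEAKER (S ⟹ P kernel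
`finiteSaturation_of_mm`; P pays only ω ≤ 3(k+1)/(k+2), kernel `omega_le_of_saturated` in the lens
draft, and holds with β ≈ 2.77 in the one-dark-vertex model); leaf IDEA-NEEDED + BARRIER(CW_q
T-methods: CLLZ Thm 3.15, tree `IsAdequate.barrier`, Table 1 `cllz2025OmegaTwoTable`) +
INSTRUMENTABLE (test T1: CLLZ eq. (5) barrier excess b_q(k) − (k+1) as k grows). [difficulty:
open-problem] -/
@[route_item "route-MatrixMultiplication-FarEdgeDescent", crux]
def FiniteSaturation : Prop :=
  ∃ k : ℕ, 2 ≤ k ∧ Literature.Computability.AlgebraicComplexity.omegaRect ℂ 1 k 1 = k + 1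

-- parent: FiniteSaturation · child (gen 1)
/--     item stmt-MatrixMultiplication-25347 · crux · rank 301 · open
    parent: FiniteSaturation · by planner
    why it might fail: the spectrum of shapes may be log-blunt at the far edge — profile e(k) ~ c/log k, exactly what every first-power CW_q design gives (c = log 2) — in which case no δ > 0 exists; consistent with every proved constraint (e ≥ 0, non-increasing, convex, → 0).
    sources: LottiRomani1983, Coppersmith1982, LeGall2012, ChristandlLeGallLysikovZuiddam2025, VassilevskaWilliamsXuXuZhou2024
[crux · split child 1 of FiniteSaturation · RUNG 1 of the special side (order-of-contact ladder,
critic w1) · tag WEAKER (than FiniteSaturation: kernel `powerAmortisation_of_finiteSaturation` in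
the lens draft HOME/decomp-mm-lens-2/FarEdgeDescent_v2.lean; than S: true in the power world e(k) =
(ω−2)/k and in the one-dark-vertex world) · leaf ATTACKABLE-IN-CLASS (census T1', this lens: the
catalogued RectangularBarrier excess of every fixed CW_q at shape (1,p,1) is Θ_q(1/(p log² p)) —
1.86e-2, 6.46e-3, 2.31e-3, 8.56e-4, 3.29e-4 at p = 4..64 — two orders below the best method excess
log 2/log(2p+2); CW_q degeneration methods are NOT barred from any δ < 1) + IDEA-NEEDED (no design
since Lotti–Romani 1983 improves the ORDER 1/log k of ω(1,k,1) − k − 1) + INSTRUMENTABLE (T1'':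
large-κ excess profile of the second-power CW_q laser method)] POLYNOMIAL AMORTISATION (Hölder order
of contact of the spectrum of shapes with the far edge): there are δ > 0 and C with ω(1,k,1) − (k+1)
≤ C·k^{−δ} for every integer k ≥ 1. Rungs beneath it (asides): LogRate (e(k) ≤ log 2/log(2k+2),
PROVED modulo the tree theorem PerfectAmortisation.omegaRect_le_of_packing) < SubLogRate (e =
o(1/log k)) < this. -/
@[route_item "route-MatrixMultiplication-FarEdgeDescent", crux]
def PowerAmortisation : Prop :=
  ∃ δ C : ℝ, 0 < δ ∧ ∀ k : ℕ, 1 ≤ k → Literature.Computability.AlgebraicComplexity.omegaRect ℂ 1 k 1 - (k + 1) ≤ C * (k : ℝ) ^ (-δ)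

-- parent: FiniteSaturation · child (gen 1)
/--     item stmt-MatrixMultiplication-25348 · crux · rank 302 · open
    parent: FiniteSaturation · by planner
    why it might fail: the true contact may be Hölder with exponent γ ∈ (0,1), e(k) ~ k^{−γ/(1−γ)}: then every octave shrinks the excess by the fixed factor 2^{−γ/(1−γ)} < 1 and the statement fails for λ below its inverse.
    sources: LottiRomani1983, HuangPan1998, ChristandlLeGallLysikovZuiddam2025
[crux · split child 2 of FiniteSaturation · the RIGIDITY half of the special side · tag WEAKER (than
FiniteSaturation: kernel `octaveFlatness_of_finiteSaturation`; than S: true in the log world e(k) =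
c/log 2k, ratio log 2k/log 4k → 1, and in the one-dark-vertex world; FALSE in the power world, ratio
2^{−δ} — so independent of PowerAmortisation) · NOT the bare residual: it implies `PowerAmortisation
→ FiniteSaturation` (kernel `residual_of_octaveFlatness`) and says more (Karamata slow variation) ·
leaf IDEA-NEEDED (wanted: an UN-BLOCKING inequality transporting algorithms for ⟨n, n^{2k}, n⟩ down
to ⟨n, n^k, n⟩ with vanishing loss in the excess; blocking gives only e(2k) ≤ e(k)) + INSTRUMENTABLE
(octave ratios ê(2k)/ê(k) of method profiles; first-power CW: log(2k+2)/log(4k+2) → 1)] OCTAVE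
FLATNESS (the excess is slowly varying along octaves, or dies): for every λ > 1 there is k₀ ≥ 1 with
ω(1,k,1) − (k+1) ≤ λ·(ω(1,2k,1) − (2k+1)) for all integers k ≥ k₀. Exact split: FiniteSaturation ⟺
PowerAmortisation ∧ OctaveFlatness (kernel `finiteSaturation_iff_power_and_flat`). -/
@[route_item "route-MatrixMultiplication-FarEdgeDescent", crux]
def OctaveFlatness : Prop :=
  ∀ l : ℝ, 1 < l → ∃ k₀ : ℕ, 1 ≤ k₀ ∧ ∀ k : ℕ, k₀ ≤ k → Literature.Computability.AlgebraicComplexity.omegaRect ℂ 1 k 1 - (k + 1) ≤ l * (Literature.Computability.AlgebraicComplexity.omegaRect ℂ 1 (2 * k) 1 - (2 * k + 1))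

-- parent: FiniteSaturation · glue (gen 1)
/--     item stmt-MatrixMultiplication-25349 · support · rank 303 · closed · proved by Summit.MatrixMultiplication.MatrixMultiplication.Theorems.FarEdgeDescentGlue.finiteSaturationGlue (prover)
    parent: FiniteSaturation · GLUE: children ⟹ parent · by planner
PowerAmortisation → OctaveFlatness → FiniteSaturation: with λ = 2^{δ/2} iterate the octave
inequality j times against the power bound, e(m) ≤ λ^j e(2^j m) ≤ C m^{−δ} (2^{−δ/2})^j → 0, so e(m)
= 0 at m = k₀+1 (C ≤ 0: e(2) = 0 directly). PROVED in the lens draft: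
`finiteSaturation_of_power_of_flat` (HOME/decomp-mm-lens-2/FarEdgeDescent_v2.lean, kernel, 0 sorry)
— a prover copies it; the split is exact (`finiteSaturation_iff_power_and_flat`). -/
@[route_item "route-MatrixMultiplication-FarEdgeDescent"]
def FiniteSaturationGlue : Prop :=
  PowerAmortisation → OctaveFlatness → FiniteSaturation

-- `FiniteSaturationGlue` holds: proved by `Summit.MatrixMultiplication.MatrixMultiplication.Theorems.FarEdgeDescentGlue.finiteSaturationGlue` (its module imports this route file, so no `_holds` link can be stated here).

/-- item stmt-MatrixMultiplication-23738 · aside · rank 2 · open · by planner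
why it might fail: if β < ∞ while ω > 2 (one-dark-vertex world, β ≈ 2.77) the excess is a max of finitely many affine functions vanishing transversally and log-convexity fails at k = ⌈β⌉−1; no multiplicative interpolation of algorithms is known.
sources: LottiRomani1983, HuangPan1998, BurgisserClausenShokrollahi1997, arXiv:2604.01386
[crux] GENERIC side — three-term log-convexity of the excess on the unbalanced side: for every
integer k ≥ 2, (ω(1,k,1) − k − 1)² ≤ (ω(1,k−1,1) − k)·(ω(1,k+1,1) − k − 2). Tag WEAKER (S ⟹ P kernel
`excessLogConvexity_of_mm`; P holds for e(k) = (ω−2)/k with any ω > 2); leaf IDEA-NEEDED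
(multiplicative interpolation of defects) + INSTRUMENTABLE (test T2: discrete log-convexity of the
CLLZ eq. (5) barrier profile of CW_q and of the re-optimised laser profile at κ = 2,3,4).
[difficulty: XL] -/
@[route_item "route-MatrixMultiplication-FarEdgeDescent"]
def ExcessLogConvexity : Prop :=
  ∀ k : ℕ, 2 ≤ k → (Literature.Computability.AlgebraicComplexity.omegaRect ℂ 1 k 1 - (k + 1)) ^ 2 ≤ (Literature.Computability.AlgebraicComplexity.omegaRect ℂ 1 (k - 1) 1 - k) * (Literature.Computability.AlgebraicComplexity.omegaRect ℂ 1 (k + 1) 1 - (k + 2))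

/-- item stmt-MatrixMultiplication-25370 · aside · rank 9 · closed · proved by Summit.MatrixMultiplication.MatrixMultiplication.Theorems.FarEdgeDescentLogRate.logRate (prover) · by planner
why it might fail: it cannot: it is a theorem (tree, modulo olean); filed as the rung-0 anchor that makes the rate ladder LogRate < SubLogRate < PowerAmortisation < FiniteSaturation typed end to end.
sources: LottiRomani1983, Coppersmith1982, BurgisserClausenShokrollahi1997
[aside · RUNG 0 of the order-of-contact ladder beneath FiniteSaturation/PowerAmortisation ·
THEOREM-ANCHOR (banked context, not staffed)] LOGARITHMIC RATE: for every integer k ≥ 1, ω(1,k,1) ≤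
k + 1 + log 2/log(2k+2) — the first-power CW_{2k+2} laser method in the far-rectangular weighting,
where the entropy bound f(k,q) = (k+2)(log(q+2) − h(1/(k+2)))/log q collapses to the closed form at
q = 2k+2. PROVED in the lens draft (`logRate_of_cwFirstPowerBound`,
HOME/decomp-mm-lens-2/FarEdgeDescent_v2.lean, kernel, 0 sorry) from the hypothesis-def
CwFirstPowerBound = VERBATIM the landed tree theorem
Theorems.PerfectAmortisation.omegaRect_le_of_packing cwLaserPacking_of_stubs
(Theorems/ShapeSubmodularityPerfectAmortisation.lean; no hub olean today, lean check rc 75 unbuilt)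
— a prover closes this item by that one-line discharge once the module builds. Print: Lotti–Romani
1983 Prop. 4.1 (spacing 1 + O(1/ln n)), BCS Notes 15 p.455. -/
@[route_item "route-MatrixMultiplication-FarEdgeDescent"]
def LogRate : Prop :=
  ∀ k : ℕ, 1 ≤ k → Literature.Computability.AlgebraicComplexity.omegaRect ℂ 1 k 1 ≤ k + 1 + Real.log 2 / Real.log (2 * k + 2)

-- `LogRate` holds: proved by `Summit.MatrixMultiplication.MatrixMultiplication.Theorems.FarEdgeDescentLogRate.logRate` (its module imports this route file, so no `_holds` link can be stated here).

/-- item stmt-MatrixMultiplication-25371 · aside · rank 9 · open · by planner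
why it might fail: every known design is log-blunt with constant ≈ log 2 up to lower-order laser refinements; a log-blunt spectrum body (support profile s(t) ~ 1/log(1/t)) is consistent with all proved constraints.
sources: LottiRomani1983, LeGall2012, ChristandlLeGallLysikovZuiddam2025
[aside · RUNG ½ · tag WEAKER (below PowerAmortisation: kernel `subLogRate_of_powerAmortisation`, log
k = o(k^δ); above the theorem LogRate) · leaf INSTRUMENTABLE (T1'': does the second-power CW_q laser
method change only the constant log 2 or the order?) + NOT BARRED (T1': CW_q barrier excess Θ(1/(k
log² k)) ≪ 1/log k)] SUB-LOGARITHMIC RATE: e(k) = ω(1,k,1) − (k+1) = o(1/log k), i.e. for every c >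
0, eventually e(k) ≤ c/log k. The cheapest typed open statement on the far-edge axis: any design
beating the ORDER of Lotti–Romani/Coppersmith amortisation proves it; the question appears unasked
in print (presearch: corpus + galaxy, no hits on the rate of ω(1,1,k) − k − 1 beyond Lotti–Romani's
1 + O(1/ln n)). -/
@[route_item "route-MatrixMultiplication-FarEdgeDescent", crux]
def SubLogRate : Prop :=
  ∀ c : ℝ, 0 < c → ∃ k₀ : ℕ, 2 ≤ k₀ ∧ ∀ k : ℕ, k₀ ≤ k → Literature.Computability.AlgebraicComplexity.omegaRect ℂ 1 k 1 - (k + 1) ≤ c / Real.log k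

/-- item stmt-MatrixMultiplication-26556 · aside · rank 9 · open · by planner
why it might fail: ω > 2 with unbounded doubling defect is consistent with everything proved (convexity, 1-Lipschitz, LogRate): e.g. stretched-exponential decay e(k) ≈ c·r^k·e^{μ√k} (kernel `stretchWorld_not_bdd`), or any zero-free superexponential contact (Gaussian world) — there BDD is false by `closes_bddSec`.
sources: LottiRomani1983, Coppersmith1982, HuangPan1998, BurgisserClausenShokrollahi1997, arXiv:2307.06535
[aside · gen 18 · the DEFECT DIAL of the generic leaf (OPS named-rung rule; cut, cone and `closes`
UNCHANGED)] BOUNDED DOUBLING DEFECT (BDD): there is a constant C with e(m)² ≤ C·(ω−2)·e(2m−1) for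
every real m > 1, e(x) := ω(1,x,1) − (x+1) — along the doubling m ↦ 2m−1 of the shape exponent the
excess loses at most a bounded factor against log-convexity through the square (C = 1 IS the crux
AnchoredLogConvexity, 28900). KERNEL (gen 18, Theorems/FarEdgeDescentDefectDial.lean, rc0 · 0 sorry;
imports the landed FarEdgeDescentExpFloor, re-uses `orbit_floor`, restates nothing): (i) EXPONENTIAL
FLOOR UNDER BOUNDED DEFECT — BDD_C ∧ ω > 2 ⟹ e(K) ≥ ((ω−2)/4C)·exp(−4·log(2C)·((3−ω)/(ω−2))·(K−1))
for every real K > 1 (`expFloor_of_bdd`; orbit floor with anchor value C·w stopped at depth 2^j ∈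
[2a, 4a+2], a = ((3−ω)/(ω−2))(K−1), where the Lotti–Romani anchor line still gives e(m_j) ≥
(ω−2)/2), hence ∃ ρ > 0, e(k) ≥ ρ^k at every k ≥ 1 (`geometric_floor_of_bdd`); (ii) TWO EXACT CUTS
with this weaker generic leaf — S ⟺ FiniteSaturation ∧ BDD (`node_bddFs_iff`, `closes_bddFs`) and S
⟺ SuperExpContact ∧ BDD (`node_bddSec_iff`, `closes_bddSec`); (iii) THE DIAL — RealLogConvexity
(28902) ⟹ AnchoredLo -/
@[route_item "route-MatrixMultiplication-FarEdgeDescent"]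
def BoundedDoublingDefect : Prop :=
  ∃ C : ℝ, ∀ m : ℝ, 1 < m → (Literature.Computability.AlgebraicComplexity.omegaRect ℂ 1 m 1 - (m + 1)) ^ 2 ≤ C * (Literature.Computability.AlgebraicComplexity.omegaRect ℂ 1 1 1 - 2) * (Literature.Computability.AlgebraicComplexity.omegaRect ℂ 1 (2 * m - 1) 1 - 2 * m)

/-- item stmt-MatrixMultiplication-27344 · aside · rank 9 · open · by planner
why it might fail: ω > 2 with a non-summable doubling defect is consistent with all that is proved (convexity, 1-Lipschitz, LogRate): any zero-free superexponential contact (Gaussian / gamma-type decay, `gammaWorld_not_sld`) or a breathing profile (`breathWorld_not_sld`) violates SLD — false there by `closes_sldSec`.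
sources: LottiRomani1983, Coppersmith1982, HuangPan1998, BurgisserClausenShokrollahi1997, arXiv:2307.06535
[aside · gen 19 · the SUMMABLE ENDPOINT of the defect dial of the generic leaf (OPS named-rung rule;
cut, cone and `closes` UNCHANGED)] SUMMABLE LOG-DEFECT (SLD): there is a dyadic ENVELOPE C : ℕ → ℝ,
C_i ≥ 1, with e(m)² ≤ C_i·(ω−2)·e(2m−1) for every real shape 1 < m ≤ 2^i + 1 and Σ_i log(C_i)/2^i <
∞, e(x) := ω(1,x,1) − (x+1). The constant envelope is BoundedDoublingDefect (26556), C ≡ 1 is the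
crux AnchoredLogConvexity (28900); SLD lets the doubling defect GROW with the scale (any growth
whose logarithm is summable against dm/m²: polynomial, exp(m^θ) with θ < 1, …). KERNEL (gen 19,
Theorems/FarEdgeDescentSummableDefect.lean, rc0 · 0 sorry · std axioms; imports the landed
FarEdgeDescentDefectDial, restates nothing): (i) ORBIT WITH BUDGET — along the halving orbit m_j = 1
+ (K−1)/2^j the envelope law with scale-dependent defects D_j gives the product form
w·(E(m_J)/w)^(2^J) ≤ E(K)·∏_{j<J} D_j^(2^j) (`orbit_budget`); stopped at depth 2^J ∈ [2a, 4a+2], a =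
((3−ω)/(ω−2))(K−1), where the Lotti–Romani anchor line still gives e(m_J) ≥ (ω−2)/2
(`stopped_orbit`), the price is the DYADIC BUDGET Σ_{j<J} 2^j·log D_j ≤ (2^N/2)·Σ_{i<N} log(C_i)/2^i
+ 2^J·log C_0 with K − 1 ≤ 2^N ≤ 2K (`level_bu -/
@[route_item "route-MatrixMultiplication-FarEdgeDescent"]
def SummableLogDefect : Prop :=
  ∃ C : ℕ → ℝ, (∀ i, 1 ≤ C i) ∧ Summable (fun i : ℕ => Real.log (C i) / 2 ^ i) ∧ ∀ (i : ℕ) (m : ℝ), 1 < m → m ≤ 2 ^ i + 1 → (Literature.Computability.AlgebraicComplexity.omegaRect ℂ 1 m 1 - (m + 1)) ^ 2 ≤ C i * (Literature.Computability.AlgebraicComplexity.omegaRect ℂ 1 1 1 - 2) * (Literature.Computability.AlgebraicComplexity.omegaRect ℂ 1 (2 * m - 1) 1 - 2 * m)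

/-- item stmt-MatrixMultiplication-27702 · aside · rank 9 · open · by planner
why it might fail: ω > 2 with a doubling defect growing faster than exponentially (Gaussian-type contact w·exp(−u²): defect exp(2u²), `gaussWorld₂_not_edd`) is consistent with every proved law (convexity, 1-Lipschitz, LogRate); false there by `closes_eddSfc`.
sources: LottiRomani1983, Coppersmith1982, HuangPan1998, BurgisserClausenShokrollahi1997
[aside · gen 20 · the next notch DOWN the generic dial, past the summable endpoint — read by the
halving engine only against a STRONGER contact leaf (OPS named-rung rule; cut, cone and `closes`
UNCHANGED)] EXPONENTIAL DOUBLING DEFECT (EDD): ∃ C, A with e(m)² ≤ C·exp(A(m−1))·(ω−2)·e(2m−1) for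
every real shape m > 1, e(x) := ω(1,x,1) − (x+1). A = 0 is BoundedDoublingDefect (26556); a summable
dyadic envelope (SummableLogDefect 27344) has log C_i ≤ B·2^i, i.e. is an exponential one; EDD lets
the doubling defect grow EXPONENTIALLY in the shape (dyadically log C_i = O(2^i) — exactly the
growth of gen 19's gamma world, where the ℓ¹ engine with partner SuperExpContact (28901) fails).
KERNEL (gen 20, Theorems/FarEdgeDescentTradeoff.lean, rc0 · 0 sorry · std axioms; imports the landed
FarEdgeDescentSummableDefect, restates nothing): (i) ENGINE — along the halving orbit m_j = 1 +
(K−1)/2^j the level-j defect is D_j = C·exp(A(K−1)/2^{j+1}) and EVERY LEVEL PAYS THE SAME A(K−1)/2: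
price (2^J − 1)·log C + J·A(K−1)/2 at the stopping depth 2^J ≤ 4a+2, a = ((3−ω)/(ω−2))(K−1), J =
O(log K) (`orbit_floor_expDefect`), hence a FACTORIAL FLOOR: EDD ∧ ω > 2 ⟹ ∃ c > 0 ∀ k ≥ 2, e(k) ≥
exp(−c·k·log k) (`fac -/
@[route_item "route-MatrixMultiplication-FarEdgeDescent"]
def ExpDoublingDefect : Prop :=
  ∃ C A : ℝ, ∀ m : ℝ, 1 < m → (Literature.Computability.AlgebraicComplexity.omegaRect ℂ 1 m 1 - (m + 1)) ^ 2 ≤ C * Real.exp (A * (m - 1)) * (Literature.Computability.AlgebraicComplexity.omegaRect ℂ 1 1 1 - 2) * (Literature.Computability.AlgebraicComplexity.omegaRect ℂ 1 (2 * m - 1) 1 - 2 * m)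

/-- item stmt-MatrixMultiplication-27703 · aside · rank 9 · open · by planner
why it might fail: ω > 2 with e(k) ≥ exp(−c·k·log k) for all k (gamma-type or slower contact; every CW_q profile is log-blunt, e(k) ≍ log 2/log k) — exactly the factorial floor that ExpDoublingDefect forces when ω > 2.
sources: LottiRomani1983, Coppersmith1982, HuangPan1998, LeGall2012
[aside · gen 20 · one notch UP the contact scale of the special leaf: FiniteSaturation (23739) ⟹ SFC
⟹ SuperExpContact (28901) (OPS named-rung rule; cut, cone and `closes` UNCHANGED)] SUPERFACTORIAL
CONTACT (SFC): for every c > 0 there is an integer shape k ≥ 2 with e(k) = ω(1,k,1) − (k+1) <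
exp(−c·k·log k) — the excess dips below every FACTORIAL rate k^{−ck} (SuperExpContact: below every
exponential rate ρ^k; FiniteSaturation: a zero). KERNEL (gen 20,
Theorems/FarEdgeDescentTradeoff.lean + FarEdgeDescentContactScale.lean, rc0 · 0 sorry · std axioms):
`sfc_of_fs` (23739 → SFC), `sec_of_sfc` (SFC → 28901: exp(−c·k·log k) ≤ ρ^k once c ≥ |log ρ|/log 2),
necessity ω = 2 → SFC (`sfc_of_mm`), the TRADED EXACT CUT S ⟺ SFC ∧ ExpDoublingDefect
(`node_eddSfc_iff`: SFC is exactly the contact leaf that the factorial floor under an exponentially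
growing doubling defect can read), the residual law (SFC → S) ⟺ (ω > 2 → ∃ c > 0 ∀ k ≥ 2, e(k) ≥
exp(−c·k·log k)) (`sfcResidual_iff_factorialFloorLaw`), and STRICT placement by model worlds: the
gamma world has SuperExpContact-shape contact but a factorial floor (`gammaWorld_factorialFloor`:
SEC ⊋ SFC), the Gaussian world w·exp(−u²) has SFC-shape contac -/
@[route_item "route-MatrixMultiplication-FarEdgeDescent"]
def SuperFactorialContact : Prop :=
  ∀ c : ℝ, 0 < c → ∃ k : ℕ, 2 ≤ k ∧ Literature.Computability.AlgebraicComplexity.omegaRect ℂ 1 k 1 - (k + 1) < Real.exp (-(c * k * Real.log k))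

/-- item stmt-MatrixMultiplication-27850 · aside · rank 9 · open · by planner
why it might fail: ω > 2 with a transversal last kink of the true profile (one-dark-vertex world max(3, x+1): Δ_MM polyhedral at the far edge, a vertex off the information facet) is consistent with every proved law (convex, 1-Lipschitz, LogRate); also false in a kinked log-convex world where ALC holds.
sources: LottiRomani1983, HuangPan1998, Coppersmith1982, Coppersmith1997, LeGallUrrutia2018
[aside · gen 21 · the generic leaf of the REGULARITY CUT — a cut of a different KIND from the
multiplicative dial (no law e(m)² ≤ D·e(1)·e(2m−1), no halving engine): read by TRANSVERSALITY
against the aside TameProfile (31917) (OPS named-rung rule; cut, cone and `closes` UNCHANGED)]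
SMOOTH PROFILE: the far-edge exponent x ↦ ω(1,x,1) (exponent of ⟨n, n^x, n⟩) is differentiable at
every real shape x > 1 — «the exponent of rectangular matrix multiplication has no first-order phase
transition». KERNEL (gen 21, Theorems/FarEdgeDescentSmoothCut.lean, rc0 · 0 sorry · std axioms;
imports the landed FarEdgeDescentTameProfile, restates nothing): (i) EXACT CUT ω(ℂ) = 2 ⟺
TameProfile ∧ SmoothProfile (`node_tameSmooth_iff`, `closes_tame_smooth`): TameProfile →
FiniteSaturation makes f(m) = ω(1,m,1) equal to m + 1 from some shape on, so every affine piece has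
slope ≤ 1; the LAST crossing b of a piece of slope a < 1 with the information line m + 1 is either ≤
1 — then the profile is saturated at shapes arbitrarily close to the square and ω = 2 (Lotti–Romani,
tree `mm_of_saturation_near_square`) — or a TRANSVERSAL CONTACT b > 1: f = m + 1 on [b, ∞) and f(x)
≥ f(b) − a(b − x) on [1, b] (`transversa -/
@[route_item "route-MatrixMultiplication-FarEdgeDescent"]
def SmoothProfile : Prop :=
  ∀ x : ℝ, 1 < x → DifferentiableAt ℝ (fun y : ℝ => Literature.Computability.AlgebraicComplexity.omegaRect ℂ 1 y 1) x

/-- item stmt-MatrixMultiplication-28901 · aside · rank 9 · open · by planner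
why it might fail: ω > 2 with e(k) ≥ c·r^k for all k (exponential-or-slower contact, e.g. the 1/log k decay every CW_q profile shows); barred in-class for CW_q T-methods (CLLZ barrier excess Θ(1/(k log²k))).
sources: LottiRomani1983, Coppersmith1982, ChristandlLeGallLysikovZuiddam2025
[aside · gen 6 · RUNG of the order-of-contact ladder strictly between FiniteSaturation (stmt-23739)
and the slower rungs (PowerAmortisation 25347, SubLogRate 25371, LogRate 25370 landed):
SUPEREXPONENTIAL CONTACT, liminf_k e(k)^(1/k) = 0 · banked context for the certified DEEPER CUT B: S
⟺ SuperExpContact ∧ RealLogConvexity (kernels `closes_superexp`, `node_superexp_iff`, 0 sorry,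
axioms standard, in HOME/decomp-mm-lens-2/FarEdgeDescent_v6.lean: the integer slices of the law give
ratio monotonicity e(1)e(k+1) ≥ e(2)e(k) and the geometric floor e(1)^(k−2)·e(k) ≥ e(2)^(k−1)
(`ex_geometric_floor`), so superexponential contact forces e(1) = 0 or e(2) = 0, and a zero at shape
2 halves down to the square) · tags NEC (kernel `superExpContact_of_mm`), WEAKER than
FiniteSaturation (FS ⟹ it, kernel `superExpContact_of_finiteSaturation`; strictly: the world e =
c·exp(−k²) is convex, 1-Lipschitz, under LogRate, zero-free) hence than S, BARRIER(CW_q T-methods: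
the CLLZ barrier excess Θ(1/(k log²k)) bars every faster decay in-class, as for FiniteSaturation),
IDEA-NEEDED · serving cut B instead of the filed cut means re-homing
PowerAmortisation/OctaveFlatness under this rung (gate-level restructu -/
@[route_item "route-MatrixMultiplication-FarEdgeDescent"]
def SuperExpContact : Prop :=
  ∀ ρ : ℝ, 0 < ρ → ∃ k : ℕ, 2 ≤ k ∧ Literature.Computability.AlgebraicComplexity.omegaRect ℂ 1 k 1 - (k + 1) < ρ ^ k

/-- item stmt-MatrixMultiplication-28902 · aside · rank 9 · open · by planner
why it might fail: as AnchoredLogConvexity (its slice): kink or polytope worlds with ω > 2; additionally local log-concavity between two far shapes k ± h with k − h ≥ 1.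
sources: LottiRomani1983, HuangPan1998, BurgisserClausenShokrollahi1997
[aside · gen 6 · the FULL LAW (C⁺) of which the crux AnchoredLogConvexity is the h = m−1 slice and
rev-2's ExcessLogConvexity (stmt-23738) the integer h = 1 slice (kernels
`anchored_of_realLogConvexity`, `excessLogConvexity_of_realLogConvexity` in
HOME/decomp-mm-lens-2/FarEdgeDescent_v6.lean): real three-term log-convexity of the excess on the
domain k − h ≥ 1 — never across the square (the across-square e-form at (0,1,2) is EXACTLY
SquareLink, kernel `squareLink_iff_across`; the d-form d = ω(1,·,1) − 2 across the square is the
SUMMIT itself, `dualDefectAcross_iff_mm` — the two costume certificates that fix this placement) ·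
tags NEC (kernel `realLogConvexity_of_mm`), WEAKER (power / exponential / log worlds; fails in kink
and polytope worlds), INSTRUMENTED (T2ʳ-S symmetric real grid: all ok for real q — integer-q small-h
failures at q-switches are min-kinks of the CW_q family, an artefact of fixing q; printed-table
triples (1.5 ± 0.5), (2 ± 0.5), (2 ± 1), (2.5 ± 0.5), (1.1 ± 0.1): ratios 1.069, 1.037, 1.178,
1.024, 1.0044, all ≥ 1; elc_t2r.out, elc_t2r_print.out) · the generic binder of cut B
(`closes_superexp`)] REAL LOG-CONVEXITY OF THE EXCESS: for all real k, h with 0 < h and 1 -/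
@[route_item "route-MatrixMultiplication-FarEdgeDescent"]
def RealLogConvexity : Prop :=
  ∀ k h : ℝ, 0 < h → 1 ≤ k - h → (Literature.Computability.AlgebraicComplexity.omegaRect ℂ 1 k 1 - (k + 1)) ^ 2 ≤ (Literature.Computability.AlgebraicComplexity.omegaRect ℂ 1 (k - h) 1 - (k - h + 1)) * (Literature.Computability.AlgebraicComplexity.omegaRect ℂ 1 (k + h) 1 - (k + h + 1))

/-- item stmt-MatrixMultiplication-30671 · aside · rank 9 · open · by planner
why it might fail: R̃(cw_q) may sit strictly between q+1 and q+2 for every q ≥ 3 (CGLV rigidity of low Kronecker powers; Alman–Li only gives η_q ≤ 1 − 2^{−Θ(q)}).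
sources: ConnerGesmundoLandsbergVentura2019:arXiv:1909.04785, AlmanLi2026, CoppersmithWinograd1990, Strassen1991
[aside · ω-FREE TRANSFER of the special leaf FiniteSaturation (stmt-…-23739) to ONE explicit tensor
· tag UNDECIDED (implied by Strassen's asymptotic rank conjecture for the single tensor cw_{k+1}; no
method proves R̃ > flattening rank for any explicit tensor, so not refutable today) · leaf
INSTRUMENTABLE (ranks / border ranks of Kronecker powers cw_q^{⊠N}; CGLV: no saving at N = 2 (q > 2)
and N = 3 (q > 4), q = 3 cube open) · NOT BARRED (at deficiency 0 the CLLZ/CVZ host barrier for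
cw_{k+1} in direction (1,k,1) equals k+1 exactly = the certificate value)] LITTLE-CW FLATNESS: for
some k ≥ 2 the little Coppersmith–Winograd tensor cw_{k+1} = Σ_{i=1}^{k+1}(x₀yᵢzᵢ+xᵢy₀zᵢ+xᵢyᵢz₀) ∈
(ℂ^{k+2})^{⊗3} has asymptotic rank equal to its flattening rank k+2 (known: k+2 ≤ R̃ ≤ bR = k+3,
Alman–Li: R̃ < k+3). EDGE (landed chain Theorems.LittleCwFarEdgeBound + transfer module):
LittleCwFlat → FiniteSaturation (`finiteSaturation_of_littleCwMinimal`, sweet spot q = k+1 of the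
little-CW far-edge certificate (k+2)^{ω(1,k,1)} ≤ C(a,b)^{-1} R̃(cw_q)^{1+kb}: at R̃ = q+1 the bound
is exactly k+1). NECESSITY (S → LittleCwFlat) is OPEN and is exactly the MM-cheapness of cw_{k+1}
(cw^{⊠N} ⊴ ⟨a,b,c⟩ at flatten -/
@[route_item "route-MatrixMultiplication-FarEdgeDescent", crux]
def LittleCwFlat : Prop :=
  ∃ k : ℕ, 2 ≤ k ∧ Literature.Computability.AlgebraicComplexity.asymptoticRank (Literature.Computability.AlgebraicComplexity.cwTensor ℂ (k + 1)) ≤ (k : ℝ) + 2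

/-- item stmt-MatrixMultiplication-30672 · aside · rank 9 · open · by planner
why it might fail: every known cw_q design is a fixed Kronecker power whose deficiency saving does not improve with q; η_q bounded below by a constant for all q is consistent with everything proved.
sources: ConnerGesmundoLandsbergVentura2019:arXiv:1909.04785, AlmanLi2026, LottiRomani1983, ChristandlLeGallLysikovZuiddam2025
[aside · ω-FREE TRANSFER of the converting child PowerAmortisation (stmt-…-25347) to the deficiency
η_q := R̃(cw_q) − (q+1) of the little-CW family · tag UNDECIDED (weaker than LittleCwFlat-for-all-q
= ARC on the family; not refutable by any known lower-bound method) · leaf IDEA-NEEDED-in-class but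
INSTRUMENTABLE (a Kronecker-power design for cw_q whose saving improves with q by a power; CGLV:
powers 2,3 rigid) · NOT BARRED (barrier value tends to k+1 as η → 0)] LITTLE-CW DEFICIENCY DECAY: ∃
γ > 0, C with R̃(cw_q) ≤ q + 1 + C·q^{−γ} for all q ≥ 2 (known: 0 ≤ η_q ≤ 1, Alman–Li η_q < 1).
EDGES (landed chain + transfer module, dictionary `excess_le_of_littleCwDeficiency`: R̃(cw_{k+1}) ≤
k+2+η ⟹ e(k) ≤ η/log(k+1)): LittleCwDeficiencyDecay → PowerAmortisation
(`powerAmortisation_of_littleCwDeficiencyDecay`); the o(1) version → SubLogRate; the C log q/q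
version → OctaveBudget.LinearExcessDecay (lens 5). It replaces the ω-bearing rate question on e(k)
by a rank question on one explicit tensor per q; necessity open (MM-cheapness of cw_q, as for
LittleCwFlat). -/
@[route_item "route-MatrixMultiplication-FarEdgeDescent", crux]
def LittleCwDeficiencyDecay : Prop :=
  ∃ γ C : ℝ, 0 < γ ∧ ∀ q : ℕ, 2 ≤ q → Literature.Computability.AlgebraicComplexity.asymptoticRank (Literature.Computability.AlgebraicComplexity.cwTensor ℂ q) ≤ (q : ℝ) + 1 + C * (q : ℝ) ^ (-γ)

/-- item stmt-MatrixMultiplication-31917 · aside · rank 9 · open · by planner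
why it might fail: ω > 2 with a ROUND spectrum body at the far edge (e(k) ~ c/log k or c·k^{−δ} for ever: infinitely many kinks or a strictly convex tail) is consistent with every proved law; nothing known makes Δ_MM finitely generated (BCLSZ discreteness is about Q̃/slice rank, not R̃).
sources: arXiv:2604.01386, LottiRomani1983, BurgisserClausenShokrollahi1997
[aside · gen 11 · WORLD statement outside the cone (OPS named-rung rule) · the ω-shadow of
«Strassen's spectrum body Δ_MM is POLYHEDRAL near the far edge» — the «polytope / one-dark-vertex
worlds» named in the docstrings of AnchoredLogConvexity / ExcessLogConvexity since gen 2, now TYPED]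
TAME (SEMILINEAR) FAR-EDGE PROFILE: on the unbalanced side m ≥ 1 the exponent m ↦ ω(1,m,1) is the
maximum of FINITELY MANY affine functions. KERNEL (gen 11,
HOME/decomp-mm-lens-2/gen11/FarEdgeDescentTameProfile.lean, rc0 · 0 sorry): (i) ω = 2 ⟹ TameProfile
(one piece m+1, `tame_of_mm`) — tag NEC; (ii) TameProfile ⟹ FiniteSaturation
(`finiteSaturation_of_tame`: among finitely many affine pieces one dominates for large m; an
eventually-affine profile squeezed between m+1 and m+1+log 2/log(2m+2) (LogRate, item 25370, PROVED)
has slope 1 and intercept 1) — SUFFICIENT for the special leaf; (iii) the special leaf itself is a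
tameness statement with NO constants: FiniteSaturation ⟺ «ω(1,·,1) is eventually affine»
(`finiteSaturation_iff_eventuallyAffine`); (iv) hence S ⟺ TameProfile ∧ AnchoredLogConvexity
(`node_tame_iff`, the lens-2 DICHOTOMY FORM of the node: in a tame world the law decides the summit, -/
@[route_item "route-MatrixMultiplication-FarEdgeDescent", crux]
def TameProfile : Prop :=
  ∃ N : ℕ, ∃ α β : Fin (N + 1) → ℝ, ∀ m : ℝ, 1 ≤ m → IsGreatest (Set.range fun i : Fin (N + 1) => α i * m + β i) (Literature.Computability.AlgebraicComplexity.omegaRect ℂ 1 m 1)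

/-- item stmt-MatrixMultiplication-33239 · aside · rank 9 · closed · proved by Summit.MatrixMultiplication.MatrixMultiplication.Theorems.FarEdgeDescentLogRateSharp.logRateSharp (planner) · by planner
why it might fail: none as a statement — it is PROVED in kernel (gen 14 file, rc0 · 0 sorry); the only residual risk is gate-side (the proof module imports Theorems.FarEdgeDescentLogRate, whose chain imports this route file: lint.theses-cone is advisory today).
sources: Coppersmith1982, LottiRomani1983, CoppersmithWinograd1990, arXiv:1204.1111, arXiv:2604.01386, BurgisserClausenShokrollahi1997
[aside · gen 14 · PROVED named rung on the SPECIAL side's rate ladder (OPS named-rung rule; cut,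
cone and `closes` UNCHANGED)] SHARP LOGARITHMIC RATE OF THE FIRST-POWER CW CLASS: for every c > c₁
:= (3/2)·log 3 − 2·log 2 = log(3√3/4) = 0.26162…, eventually e(k) = ω(1,k,1) − (k+1) ≤ c / log k.
LADDER: LogRate (25370, proved: e(k) ≤ log 2/log(2k+2), constant 0.693) < LogRateSharp (constant
0.2616, eventual) < SubLogRate (25371: every c > 0) < PowerAmortisation (25347) < FiniteSaturation
(23739). KERNEL (gen 14, Theorems/FarEdgeDescentLogRateSharp.lean, rc0 · 0 sorry · std axioms;
imports and never restates the landed certificate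
FarEdgeDescentLogRate.cwFirstPowerIntegerCertificate_holds): the SAME landed full first-power
certificate evaluated at the dilute scalar rate q = k, r = 0, σ = t/(k+2+2t), rational t = s/m ↑ 1/2
— exact finite-k excess identity K(log(k+2) − H_Y) − (k+1)log k = K log((k+2)/K) + (k+1)log(1+1/k) +
φ(t) (farEdge_excess_identity), bound ≤ 1 − 2t + φ(t) + 1/k (farEdge_excess_bound), X/Y balance H_Y
≤ H_X once (1−2t)log(k+1) ≥ 2log2 − φ(t) (farEdge_balance), and 1 − 2t + φ(t) → c₁ as t ↑ 1/2
(phiT_half, farEdge_exists_rate), φ(t) = (1+t)log(1+t) + t log t; enclosure -/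
@[route_item "route-MatrixMultiplication-FarEdgeDescent"]
def LogRateSharp : Prop :=
  ∀ c : ℝ, 3 / 2 * Real.log 3 - 2 * Real.log 2 < c → ∃ k₀ : ℕ, 2 ≤ k₀ ∧ ∀ k : ℕ, k₀ ≤ k → Literature.Computability.AlgebraicComplexity.omegaRect ℂ 1 k 1 - (k + 1) ≤ c / Real.log k

-- `LogRateSharp` holds: proved by `Summit.MatrixMultiplication.MatrixMultiplication.Theorems.FarEdgeDescentLogRateSharp.logRateSharp` (its module imports this route file, so no `_holds` link can be stated here).

-- earlier Assembly (stmt-MatrixMultiplication-23741, replaced 2026-08-30T06:01:52Z -> stmt-MatrixMultiplication-28941): retired by None — FiniteSaturation → ExcessLogConvexity → SquareLink → _root_.MatrixMultiplication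
/-- item stmt-MatrixMultiplication-28941 · assembly · rank 1 · open · by planner
sources: LottiRomani1983, HuangPan1998
[assembly] (gen 6) FiniteSaturation → AnchoredLogConvexity → ω(ℂ) = 2: halving descent of the
saturated shape to the square along k_n = 1 + (k₀−1)/2ⁿ, closed by Lotti–Romani convexity with the
anchor ω(1,0,1) = 2 (ω ≤ 3 − 1/k_n); record of the deciding theorem `closes` (glue_v6.lean), same
statement as kernel `closes_gen6`. -/
@[route_item "route-MatrixMultiplication-FarEdgeDescent"]
def Assembly : Prop :=
  FiniteSaturation → AnchoredLogConvexity → _root_.MatrixMultiplication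

/-! D-0027 §2.1 — DECIDING THEOREM (planner-authored via `route open/edit --closes-file`; by planner-decomp-mm-lens-2-g6-0 2026-08-30T06:02:53Z):
its hypotheses are this route's items and its conclusion the sub-problem Statement (glue_lint), and it elaborates with this file. -/

@[closes "route-MatrixMultiplication-FarEdgeDescent"] theorem closes (h₁ : FiniteSaturation) (h₂ : AnchoredLogConvexity) :
    _root_.MatrixMultiplication := by
  -- (gen 6) special piece: an INTEGER saturated shape K ≥ 2, e(K) = 0
  obtain ⟨K, hK, hsat⟩ := h₁
  have hk₀ : (1 : ℝ) < (K : ℝ) := by exact_mod_cast (by omega : 1 < K)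
  -- generic piece ⇒ HALVING STEP: e(k) = 0 with k > 1 real ⇒ e((k+1)/2)² ≤ e(1)·e(k) = 0
  have step : ∀ k : ℝ, 1 < k →
      Literature.Computability.AlgebraicComplexity.omegaRect ℂ 1 k 1 = k + 1 →
      Literature.Computability.AlgebraicComplexity.omegaRect ℂ 1 ((k + 1) / 2) 1 = (k + 1) / 2 + 1 := by
    intro k hk hs
    have h := h₂ ((k + 1) / 2) (by linarith)
    have hz : Literature.Computability.AlgebraicComplexity.omegaRect ℂ 1 (2 * ((k + 1) / 2) - 1) 1
        - 2 * ((k + 1) / 2) = 0 := by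
      rw [show 2 * ((k + 1) / 2) - 1 = k by ring, hs]; ring
    rw [hz, mul_zero] at h
    have hsq := le_antisymm h (sq_nonneg _)
    have hlin := (pow_eq_zero_iff two_ne_zero).1 hsq
    linarith
  -- the halving ORBIT k_n = 1 + (K−1)/2ⁿ → 1⁺ is saturated
  have orbit : ∀ n : ℕ,
      Literature.Computability.AlgebraicComplexity.omegaRect ℂ 1 (1 + ((K : ℝ) - 1) / 2 ^ n) 1
        = (1 + ((K : ℝ) - 1) / 2 ^ n) + 1 := by
    intro n
    induction n with
    | zero =>
      have e : 1 + ((K : ℝ) - 1) / 2 ^ 0 = K := by rw [pow_zero, div_one]; ring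
      rw [e]; exact hsat
    | succ n ih =>
      have hpos : 0 < ((K : ℝ) - 1) / 2 ^ n := div_pos (by linarith) (pow_pos two_pos n)
      have h := step _ (by linarith) ih
      have e : (1 + ((K : ℝ) - 1) / 2 ^ n + 1) / 2 = 1 + ((K : ℝ) - 1) / 2 ^ (n + 1) := by
        rw [pow_succ]; field_simp; ring
      rw [e] at h
      exact h
  -- closing AT the square by a THEOREM (Lotti–Romani convexity of x ↦ ω(1,x,1) on [0,k], anchor ω(1,0,1) = 2):
  -- saturation at a real shape k > 1 gives ω ≤ 3 − 1/k, hence ω − 2 ≤ k − 1.  No square link.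
  have sq : ∀ k : ℝ, 1 < k →
      Literature.Computability.AlgebraicComplexity.omegaRect ℂ 1 k 1 = k + 1 →
      Literature.Computability.AlgebraicComplexity.omega ℂ - 2 ≤ k - 1 := by
    intro k hk1 hs
    have hk0 : 0 < k := by linarith
    have ha : 0 ≤ 1 - 1 / k := by rw [sub_nonneg, div_le_one hk0]; exact hk1.le
    have hb : (0 : ℝ) ≤ 1 / k := by positivity
    have h := Literature.Computability.AlgebraicComplexity.LottiRomani1983_convexComb_le ℂ
      (x := 1) (y := 0) (z := 1) (x' := 1) (y' := k) (z' := 1) (a := 1 - 1 / k) (b := 1 / k)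
      zero_le_one le_rfl zero_le_one zero_le_one hk0.le zero_le_one ha hb
    have e1 : (1 - 1 / k) * 1 + 1 / k * 1 = (1 : ℝ) := by ring
    have e2 : (1 - 1 / k) * 0 + 1 / k * k = (1 : ℝ) := by
      rw [mul_zero, zero_add, one_div, inv_mul_cancel₀ hk0.ne']
    rw [e1, e2, Literature.Computability.AlgebraicComplexity.omegaRect_one_one_one,
      Literature.Computability.AlgebraicComplexity.omegaRect_one_zero_one, hs] at h
    have e3 : (1 - 1 / k) * 2 + 1 / k * (k + 1) = 2 + (k - 1) / k := by
      field_simp; ring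
    have hkk : (k - 1) / k ≤ k - 1 := div_le_self (by linarith) hk1.le
    linarith
  -- conclusion: 2 ≤ ω (information bound at the square) and ω − 2 ≤ (K−1)/2ⁿ for every n
  rw [_root_.MatrixMultiplication_iff]
  have hge : 2 ≤ Literature.Computability.AlgebraicComplexity.omega ℂ := by
    have h := Literature.Computability.AlgebraicComplexity.add_one_le_omegaRect_one_mid_one ℂ 1
    rw [Literature.Computability.AlgebraicComplexity.omegaRect_one_one_one] at h
    linarith
  have hle : Literature.Computability.AlgebraicComplexity.omega ℂ ≤ 2 := by
    by_contra hlt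
    rw [not_le] at hlt
    have hk1 : 0 < (K : ℝ) - 1 := by linarith
    obtain ⟨n, hn⟩ := exists_pow_lt_of_lt_one
      (div_pos (by linarith : 0 < Literature.Computability.AlgebraicComplexity.omega ℂ - 2) hk1)
      (by norm_num : (1 / 2 : ℝ) < 1)
    have hpos : 0 < ((K : ℝ) - 1) / 2 ^ n := div_pos hk1 (pow_pos two_pos n)
    have hb := sq (1 + ((K : ℝ) - 1) / 2 ^ n) (by linarith) (orbit n)
    have e : ((K : ℝ) - 1) / 2 ^ n = (1 / 2) ^ n * ((K : ℝ) - 1) := by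
      rw [one_div_pow, mul_comm, ← div_eq_mul_one_div]
    rw [lt_div_iff₀ hk1] at hn
    rw [e] at hb
    linarith
  exact le_antisymm hle hge

end Summit.MatrixMultiplication.MatrixMultiplication.Theses.FarEdgeDescent
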